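import Mathlib
import HarnessLib
import Literature.MathematicalPhysics.KineticTheory.VelocityFlipEmbeddedChainSteadyState
import Literature.Probability.Process.HarrisTheorem
import Summits.AtomisticToContinuum.FouriersLaw.Theorems.VanishingNoiseTransferVanishingNoiseBoundUniformMinorization

/-!
# Harris' contraction for the embedded flip chain with constants UNIFORM in the bath temperatures
(helper for stub CONT `stub_flipMildContinuity`, line `fekete-usc-one-length`, crux stmt-AtomisticToContinuum-11976)

`--supports stmt-AtomisticToContinuum-11976` helper file (crux `VanishingNoiseBound`, route `VanishingNoiseTransfer`,
line `fekete-usc-one-length`, stub CONT, wave 5). For the embedded flip chain `K = Q ∘ₖ R_r` of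
`pinnedChain ω₂ lam β γ` (`VelocityFlipEmbeddedChain.lean`) the Hairer–Mattingly contraction of the `d_β`-Lipschitz
seminorm needs a drift `K e^{θH} ≤ γ₀ e^{θH} + K₀` and a minorisation `K(z,·) ≥ α ν` on `{e^{θH} ≤ R₀}`; this file
supplies the MINORISATION with `α` independent of the bath temperatures in a compact range (the drift is
`pinnedChain_resolvent_lyapunov_uniform'`, file `…FlipMildContinuityLyapunov`; the package is assembled downstream):

* `resolvent_minorization_mass` — Doeblin for the resolvent with the mass made explicit: `ν ≤ P_{t_C}(z,·)` on `C`
  gives `m ≤ R_r(z,·)` on `C` with `m(X) = ν(X) · Exp_r(t_C, ∞)`;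
* `expMeasure_Ioi_eq` — `Exp_r(a, ∞) = e^{-ra}` (`a ≥ 0`);
* `flip_embedded_minorization_uniform` — for an energy level `E` and an amplitude range `[c_min, c_max]` there is
  ONE `α > 0` such that for all bath temperatures with `√(2γT_b) ∈ [c_min, c_max]` some probability measure `ν`
  has `α ν ≤ K(z, ·)` for all `z ∈ {H ≤ E}` (`pinnedChain_minorization_uniform` ⇒ resolvent ⇒ flip);
* `helper_flipMildContinuityHarris` — registered helper (notation-free restatement of
  `flip_embedded_minorization_uniform`).

References: Hairer–Mattingly 2011; Cuneo–Eckmann–Hairer–Rey-Bellet 2018 Prop. 3.6; Bernardin–Olla 2011 §2.1.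
-/

noncomputable section

open MeasureTheory ProbabilityTheory Filter Topology Set
open scoped NNReal ENNReal Topology
open Literature.MathematicalPhysics.KineticTheory.HeatConduction Literature.Probability.Process OscillatorChain
open Summit.AtomisticToContinuum.FouriersLaw.Theorems.FixedLengthNoiseContinuity (pinnedChain_minorization_uniform)

namespace Summit.AtomisticToContinuum.FouriersLaw.Theorems.VanishingNoiseBound

/-- `Exp_r(a, ∞) = e^{-ra}` for the exponential law of rate `r > 0` and `a ≥ 0`. [folklore] -/
theorem expMeasure_Ioi_eq {r : ℝ} (hr : 0 < r) {a : ℝ} (ha : 0 ≤ a) :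
    expMeasure r (Ioi a) = ENNReal.ofReal (Real.exp (-(r * a))) := by
  haveI := isProbabilityMeasure_expMeasure hr
  have h1 : 0 ≤ 1 - Real.exp (-(r * a)) := by
    have : Real.exp (-(r * a)) ≤ 1 := Real.exp_le_one_iff.2 (by nlinarith)
    linarith
  have h2 : Real.exp (-(r * a)) = 1 - (1 - Real.exp (-(r * a))) := by ring
  rw [← compl_Iic, prob_compl_eq_one_sub measurableSet_Iic, ← ofReal_cdf, cdf_expMeasure_eq hr, if_pos ha]
  conv_rhs => rw [h2]
  rw [ENNReal.ofReal_sub _ h1, ENNReal.ofReal_one]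

/-- **Doeblin for the resolvent, with the mass**: for a Langevin-chain semigroup `S`, if a finite measure `ν`
satisfies `ν ≤ P_{t_C}(z, ·)` for all `z ∈ C`, then `m := ∫_{t > t_C} ν P_{t − t_C} Exp_r(dt)` satisfies
`m ≤ R_r(z, ·)` on `C` and `m(X) = ν(X) Exp_r(t_C, ∞)`. Proof of `exists_le_resolventKernel_of_le_kernel`
(`VelocityFlipEmbeddedChain.lean`) with the mass identity exported. [folklore] -/
theorem resolvent_minorization_mass {P : OscillatorChain} {N : ℕ} {T_L T_R : ℝ}
    (S : LangevinChainSemigroup P N T_L T_R) {r : ℝ} (hr : 0 < r) {C : Set (PhaseSpace N)}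
    {t_C : ℝ≥0} {ν : Measure (PhaseSpace N)} [IsFiniteMeasure ν] (hν : ∀ z ∈ C, ν ≤ S.kernel t_C z) :
    ∃ m : Measure (PhaseSpace N), m univ = ν univ * expMeasure r (Ioi (t_C : ℝ)) ∧
      ∀ z ∈ C, m ≤ S.resolventKernel r z := by
  -- adapted from `LangevinChainSemigroup.exists_le_resolventKernel_of_le_kernel`
  -- (Literature/MathematicalPhysics/KineticTheory/VelocityFlipEmbeddedChain.lean)
  haveI := isProbabilityMeasure_expMeasure hr
  set ρ := expMeasure r with hρ
  let K' : Kernel (ℝ × PhaseSpace N) (PhaseSpace N) :=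
    ⟨fun p => S.kernel (p.1 - t_C).toNNReal p.2,
      Measurable.comp (g := fun q : ℝ≥0 × PhaseSpace N => S.kernel q.1 q.2)
        (f := fun p : ℝ × PhaseSpace N => ((p.1 - t_C).toNNReal, p.2)) S.measurable_kernel
        (by fun_prop)⟩
  have hK' : ∀ (t : ℝ) (x : PhaseSpace N), K' (t, x) = S.kernel (t - t_C).toNNReal x := fun _ _ => rfl
  let F : ℝ → Measure (PhaseSpace N) := fun t => ν.bind fun x => K' (t, x)
  have hFapply : ∀ (t : ℝ) {A : Set (PhaseSpace N)}, MeasurableSet A →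
      F t A = ∫⁻ x, K' (t, x) A ∂ν := fun t A hA =>
    Measure.bind_apply hA (K'.measurable.comp measurable_prodMk_left).aemeasurable
  have hF : Measurable F := Measure.measurable_of_measurable_coe _ fun A hA => by
    simp_rw [hFapply _ hA]
    exact (K'.measurable_coe hA).lintegral_prod_right'
  refine ⟨(ρ.restrict (Ioi (t_C : ℝ))).bind F, ?_, fun z hz => ?_⟩
  · rw [Measure.bind_apply MeasurableSet.univ hF.aemeasurable]
    have h2 : ∀ t, F t univ = ν univ := fun t => by
      rw [hFapply t MeasurableSet.univ]
      simp only [hK', measure_univ, lintegral_const, one_mul]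
    simp_rw [h2]
    rw [lintegral_const, Measure.restrict_apply MeasurableSet.univ, univ_inter]
  · refine Measure.le_iff.2 fun A hA => ?_
    rw [Measure.bind_apply hA hF.aemeasurable, S.resolventKernel_apply hr z hA]
    refine (setLIntegral_mono' measurableSet_Ioi fun t ht => ?_).trans (setLIntegral_le_lintegral _ _)
    have ht' : (t_C : ℝ) ≤ t := le_of_lt ht
    have hu : t.toNNReal = t_C + (t - t_C).toNNReal := by
      conv_lhs => rw [← add_sub_cancel (t_C : ℝ) t]
      rw [Real.toNNReal_add t_C.coe_nonneg (sub_nonneg.2 ht'), Real.toNNReal_coe]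
    rw [hFapply t hA, hu, S.kernel_add_apply]
    simp only [hK']
    rw [← Measure.bind_apply hA (Kernel.aemeasurable _)]
    exact Measure.le_iff.1 (bind_le_bind_of_le (hν z hz) _) A hA

variable {ω₂ lam β γ : ℝ} {N : ℕ}

/-- **Minorisation of the embedded flip chain on energy sublevel sets, UNIFORM in the bath temperatures.**
For `pinnedChain ω₂ lam β γ` (`ω₂, β, γ > 0`, `lam ≥ 0`), `N ≥ 1`, a rate `r > 0`, an energy level `E` and an
amplitude range `0 < c_min ≤ c_max` there is `α > 0` such that for ALL bath temperatures `T_L, T_R ≥ 0` with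
`√(2γT_b) ∈ [c_min, c_max]` some probability measure `ν` satisfies `α ν ≤ K(z, ·)` for every `z` with `H(z) ≤ E`,
`K = Q ∘ₖ R_r` the embedded flip chain. Chain: `pinnedChain_minorization_uniform` (`P_m ≥ α₀ ν₀` on `{H ≤ E}`),
Doeblin for the resolvent (`resolvent_minorization_mass`, mass `α₀ e^{-rm}`), transport by the flip
(`bind_flipKernel_le_embeddedFlipKernel`, mass preserved), normalisation.
[cite: CuneoEckmannHairerReyBellet2018, Prop 3.6] -/
theorem flip_embedded_minorization_uniform (hω : 0 < ω₂) (hl : 0 ≤ lam) (hβ : 0 < β) (hγ : 0 < γ)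
    (hN : 0 < N) {r : ℝ} (hr : 0 < r) (E : ℝ) {cmin cmax : ℝ} (hc0 : 0 < cmin) (hcle : cmin ≤ cmax) :
    ∃ α : ℝ≥0, 0 < α ∧ ∀ (T_L T_R : ℝ) (hTL : 0 ≤ T_L) (hTR : 0 ≤ T_R),
      cmin ≤ Real.sqrt (2 * γ * T_L) → Real.sqrt (2 * γ * T_L) ≤ cmax →
      cmin ≤ Real.sqrt (2 * γ * T_R) → Real.sqrt (2 * γ * T_R) ≤ cmax →
      ∃ ν : Measure (PhaseSpace N), IsProbabilityMeasure ν ∧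
        ∀ z : PhaseSpace N, (pinnedChain ω₂ lam β γ).hamiltonian N z ≤ E →
          α • ν ≤ (pinnedChainSemigroup hω hl hβ.le hγ.le hN hTL hTR).embeddedFlipKernel r z := by
  obtain ⟨m, α₀, hm, hα₀, hmin⟩ := pinnedChain_minorization_uniform (N := N) hω hl hβ hγ hN E hc0 hcle
  -- the uniform weight `α = α₀ e^{-rm}`
  set w : ℝ≥0∞ := ENNReal.ofReal α₀ * ENNReal.ofReal (Real.exp (-(r * m))) with hw
  have hw0 : w ≠ 0 := by
    rw [hw]; exact (ENNReal.mul_pos (ENNReal.ofReal_pos.2 hα₀).ne' (ENNReal.ofReal_pos.2 (Real.exp_pos _)).ne').ne'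
  have hwtop : w ≠ ⊤ := ENNReal.mul_ne_top ENNReal.ofReal_ne_top ENNReal.ofReal_ne_top
  refine ⟨w.toNNReal, ENNReal.toNNReal_pos hw0 hwtop, fun T_L T_R hTL hTR hL1 hL2 hR1 hR2 => ?_⟩
  obtain ⟨ν₀, hν₀, hν₀min⟩ := hmin T_L T_R hL1 hL2 hR1 hR2
  haveI := hν₀
  set Sg := pinnedChainSemigroup hω hl hβ.le hγ.le hN hTL hTR with hSg
  set C : Set (PhaseSpace N) := {z | (pinnedChain ω₂ lam β γ).hamiltonian N z ≤ E} with hC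
  -- Doeblin for the resolvent, with the finite measure `α₀ ν₀`
  haveI : IsFiniteMeasure (ENNReal.ofReal α₀ • ν₀) := by
    refine ⟨?_⟩
    rw [Measure.smul_apply, smul_eq_mul, measure_univ, mul_one]
    exact ENNReal.ofReal_lt_top
  have hν₁ : ∀ z ∈ C, ENNReal.ofReal α₀ • ν₀ ≤ Sg.kernel (m : ℝ≥0) z := fun z hz => hν₀min z hz
  obtain ⟨m₁, hm₁, hm₁le⟩ := resolvent_minorization_mass Sg hr hν₁
  have hmass₁ : m₁ univ = w := by
    rw [hm₁, Measure.smul_apply, smul_eq_mul, measure_univ, mul_one, hw]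
    congr 1
    have : ((m : ℝ≥0) : ℝ) = (m : ℝ) := rfl
    rw [this, expMeasure_Ioi_eq hr (Nat.cast_nonneg m)]
  -- transport by the flip
  set m₂ : Measure (PhaseSpace N) := m₁.bind (flipKernel N) with hm₂
  have hm₂le : ∀ z ∈ C, m₂ ≤ Sg.embeddedFlipKernel r z := fun z hz =>
    LangevinChainSemigroup.bind_flipKernel_le_embeddedFlipKernel _ (hm₁le z hz)
  have hmass₂ : m₂ univ = w := by
    rw [hm₂, ← hmass₁]
    exact Measure.comp_apply_univ (κ := flipKernel N) (μ := m₁)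
  -- normalisation
  refine ⟨w⁻¹ • m₂, ⟨?_⟩, fun z hz => ?_⟩
  · rw [Measure.smul_apply, smul_eq_mul, hmass₂, ENNReal.inv_mul_cancel hw0 hwtop]
  · have h1 : (w.toNNReal : ℝ≥0) • (w⁻¹ • m₂) = m₂ := by
      rw [ENNReal.smul_def, ENNReal.coe_toNNReal hwtop, smul_smul, ENNReal.mul_inv_cancel hw0 hwtop, one_smul]
    rw [h1]
    exact hm₂le z hz

/-! ## Registered helper -/

/-- Registered helper sub-goal `helper_flipMildContinuityHarris` of stub `stub_flipMildContinuity` (line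
`fekete-usc-one-length`, crux stmt-AtomisticToContinuum-11976): the temperature-uniform minorisation of the embedded
flip chain `flip_embedded_minorization_uniform` (notation-free one-line form). -/
theorem helper_flipMildContinuityHarris : ∀ (ω₂ lam β γ : ℝ) (hω : 0 < ω₂) (hl : 0 ≤ lam) (hβ : 0 < β) (hγ : 0 < γ) (N : ℕ) (hN : 0 < N) (r : ℝ), 0 < r → ∀ (E cmin cmax : ℝ), 0 < cmin → cmin ≤ cmax → ∃ α : NNReal, 0 < α ∧ ∀ (T_L T_R : ℝ) (hTL : 0 ≤ T_L) (hTR : 0 ≤ T_R), cmin ≤ Real.sqrt (2 * γ * T_L) → Real.sqrt (2 * γ * T_L) ≤ cmax → cmin ≤ Real.sqrt (2 * γ * T_R) → Real.sqrt (2 * γ * T_R) ≤ cmax → ∃ ν : MeasureTheory.Measure (Literature.MathematicalPhysics.KineticTheory.HeatConduction.PhaseSpace N), MeasureTheory.IsProbabilityMeasure ν ∧ ∀ z : Literature.MathematicalPhysics.KineticTheory.HeatConduction.PhaseSpace N, (Literature.MathematicalPhysics.KineticTheory.HeatConduction.pinnedChain ω₂ lam β γ).hamiltonian N z ≤ E →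 α • ν ≤ (Literature.MathematicalPhysics.KineticTheory.HeatConduction.pinnedChainSemigroup hω hl (le_of_lt hβ) (le_of_lt hγ) hN hTL hTR).embeddedFlipKernel r z :=
  fun _ _ _ _ hω hl hβ hγ _ hN _ hr E _ _ hc0 hcle =>
    flip_embedded_minorization_uniform hω hl hβ hγ hN hr E hc0 hcle

end Summit.AtomisticToContinuum.FouriersLaw.Theorems.VanishingNoiseBound

end
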